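import Literature.NumberTheory.LFunctions.NoExceptionalZeroUpTo
import Literature.NumberTheory.LFunctions.SiegelTheorem
import HarnessLib

/-!
# `L(1, χ) ≫ 1/log q` for the real characters of a no-exceptional-zero table, with an EXPLICIT
# absolute constant (Estermann–Montgomery–Vaughan, Lemma 11.13 / Theorem 11.14, first case)

Topic `Literature/NumberTheory/LFunctions`; namespace `Literature.NumberTheory.LFunctions`.
Everything here is PROVED (theorems only; no definition, no named fact).

A Siegel-type lower bound `L(1, χ) ≫_ε q^{−ε}` is ineffective because of a possible exceptional
zero. For the moduli of a certified no-exceptional-zero table `NoExceptionalZeroUpTo Q c₀`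
(`NoExceptionalZeroUpTo.lean`) the FIRST case of Montgomery–Vaughan's proof of Siegel's theorem
(Thm. 11.14, p. 285: "Suppose first that there is no such zero. We take `f(s) = L(s, χ)`,
`σ = 1 − ε/4`. Then `f(σ) > 0` … Hence by Lemma 11.13, `f(1) ≫ ε q^{−3ε/8}`") applies with the
`q`-DEPENDENT width `η = min(c₀, 1/4)/log q`, and `q^{−Aη} = e^{−A min(c₀,1/4)}` is then a constant:
the tree's kernel version of that case, `Siegel.caseA`
(`estermannC · η · (ballConst · q)^{−estermannA · η} ≤ Re L(1, χ)`), yields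

* `NoExceptionalZeroUpTo.lfunction_one_re_ge` — **for every quadratic `χ ≠ χ₀` mod `q ≤ Q`
  (`q ≥ 3`): `Re L(1, χ) ≥ κ(c₀)/log q`** with the explicit absolute constant
  `κ(c₀) = estermannC · m · exp(−estermannA · m · (1 + log ballConst))`, `m = min(c₀, 1/4)`
  (`estermannA = 1/log(6/5)`, `estermannC = ½ e^{−1/4 − log 528/(4 log(6/5))}`, `ballConst` of
  `SiegelTheorem.lean` — closed-form reals of the tree);
* `exists_lfunction_one_re_ge_of_noExceptionalZeroUpTo` — the `∃ κ > 0, ∀ Q` form: the constant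
  does not depend on the level `Q` of the table (a larger table extends the RANGE, never the
  constant).

In print the sharp version over Lu–Zaman–Zhao's range is their Corollary 1.3 (`L(1, χ) ≥ 1/(8 log q)`,
`q ≤ 10¹⁰`, via Hoffstein's inequality) — typed as a named fact in
`NoExceptionalZeroUpToTenPowTen.lean`; the present file is the inexplicit-but-kernel route.

## References

* H. L. Montgomery, R. C. Vaughan, *Multiplicative Number Theory I*, CUP 2007, §11.2, Lemma 11.13
  and Theorem 11.14 (first case, p. 285). [MontgomeryVaughan2007]
* R. F. Lu, A. Zaman, H. Zhao, Math. Comp. (2026), doi:10.1090/mcom/4268, Corollary 1.3.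
  [LuZamanZhao2026]
-/

noncomputable section

open Complex Literature.Barriers.Parity

namespace Literature.NumberTheory.LFunctions

open Siegel Estermann

variable {Q : ℕ} {c₀ : ℝ}

/-- For `q ≥ 3`, `log q > 1`. [folklore] -/
private theorem one_lt_log_of_three_le' {q : ℕ} (hq : 3 ≤ q) : 1 < Real.log q := by
  have hq3 : (3 : ℝ) ≤ (q : ℝ) := by exact_mod_cast hq
  have hlog3 : 1 < Real.log 3 := by
    have h := Real.exp_one_lt_d9
    rw [Real.lt_log_iff_exp_lt (by norm_num)]
    linarith
  exact lt_of_lt_of_le hlog3 (Real.log_le_log (by norm_num) hq3)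

namespace NoExceptionalZeroUpTo

/-- **`L(1, χ) ≥ κ(c₀)/log q` on a no-exceptional-zero table, explicit `κ`.** Under
`NoExceptionalZeroUpTo Q c₀` with `c₀ > 0`: for every modulus `3 ≤ q ≤ Q` and every quadratic
`χ ≠ χ₀` mod `q`,
`estermannC · m · exp(−estermannA · m · (1 + log ballConst)) / log q ≤ Re L(1, χ)`, `m = min(c₀, 1/4)`.
Proof: `Siegel.caseA` (MV Thm. 11.14, first case) with `η = m/log q ≤ 1/4`; the table makes
`[1 − η, 1)` zero-free (`η ≤ c₀/log q`, and `1 − η > 0`); and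
`(ballConst · q)^{−estermannA η} = exp(−estermannA · m · (log ballConst + log q)/log q) ≥ exp(−estermannA · m · (1 + log ballConst))`
as `log q ≥ 1`, `log ballConst ≥ 0`. [cite: MontgomeryVaughan2007, §11.2 Thm. 11.14 (first case, p. 285)] -/
theorem lfunction_one_re_ge (h : NoExceptionalZeroUpTo Q c₀) (hc₀ : 0 < c₀) {q : ℕ} [NeZero q]
    (hq3 : 3 ≤ q) (hqQ : q ≤ Q) (χ : DirichletCharacter ℂ q) (hquad : χ.IsQuadratic) (hχ : χ ≠ 1) :
    estermannC * min c₀ (1 / 4) *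
        Real.exp (-(estermannA * min c₀ (1 / 4) * (1 + Real.log ballConst))) / Real.log q ≤
      (χ.LFunction 1).re := by
  set m : ℝ := min c₀ (1 / 4) with hm
  have hm0 : 0 < m := lt_min hc₀ (by norm_num)
  have hm4 : m ≤ 1 / 4 := min_le_right _ _
  have hmc : m ≤ c₀ := min_le_left _ _
  have hlogq : 1 < Real.log q := one_lt_log_of_three_le' hq3
  have hlogq0 : 0 < Real.log q := by linarith
  have hq0 : (0 : ℝ) < q := by exact_mod_cast (show 0 < q by omega)
  -- the width `η = m / log q`
  set η : ℝ := m / Real.log q with hη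
  have hη0 : 0 < η := div_pos hm0 hlogq0
  have hη4 : η ≤ 1 / 4 := by
    rw [hη, div_le_iff₀ hlogq0]
    nlinarith
  have hηc : η ≤ c₀ / Real.log q := div_le_div_of_nonneg_right hmc hlogq0.le
  -- zero-freeness of `[1 − η, 1)` from the table
  have hz : ∀ σ : ℝ, 1 - η ≤ σ → σ < 1 → χ.LFunction σ ≠ 0 := by
    intro σ h1 _
    have hη1 : η < 1 := by linarith
    exact h.lfunction_ne_zero hqQ χ hquad hχ (by linarith) (by linarith)
  have hA := caseA χ hχ (MulChar.isQuadratic_iff_sq_eq_one.mp hquad) hη0 hη4 hz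
  refine le_trans ?_ hA
  -- compare the constants
  have hB := one_le_ballConst
  have hB0 : 0 < ballConst := by linarith
  have hlogB : 0 ≤ Real.log ballConst := Real.log_nonneg hB
  have hBq : 0 < ballConst * q := mul_pos hB0 hq0
  have hpow : Real.exp (-(estermannA * m * (1 + Real.log ballConst))) ≤
      (ballConst * q) ^ (-estermannA * η) := by
    rw [Real.rpow_def_of_pos hBq, Real.exp_le_exp, Real.log_mul hB0.ne' hq0.ne', hη]
    have hA0 : 0 < estermannA := estermannA_pos
    -- `A (m/log q) (log B + log q) ≤ A m (1 + log B)`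
    have h1 : (Real.log ballConst + Real.log q) * (m / Real.log q) ≤ m * (1 + Real.log ballConst) := by
      rw [mul_div_assoc', div_le_iff₀ hlogq0]
      have : Real.log ballConst * m ≤ Real.log ballConst * m * Real.log q :=
        le_mul_of_one_le_right (mul_nonneg hlogB hm0.le) hlogq.le
      nlinarith
    have h2 : (Real.log ballConst + Real.log q) * (-estermannA * (m / Real.log q)) =
        -(estermannA * ((Real.log ballConst + Real.log q) * (m / Real.log q))) := by ring
    rw [h2]
    have := mul_le_mul_of_nonneg_left h1 hA0.le
    linarith
  have hC0 : 0 < estermannC := estermannC_pos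
  calc estermannC * m * Real.exp (-(estermannA * m * (1 + Real.log ballConst))) / Real.log q
      = estermannC * η * Real.exp (-(estermannA * m * (1 + Real.log ballConst))) := by
        rw [hη]; ring
    _ ≤ estermannC * η * (ballConst * q) ^ (-estermannA * η) :=
        mul_le_mul_of_nonneg_left hpow (by positivity)

end NoExceptionalZeroUpTo

/-- **`∃ κ > 0` form, constant independent of the level.** For every `c₀ > 0` there is `κ > 0`
(namely `estermannC · m · e^{−estermannA · m · (1 + log ballConst)}`, `m = min(c₀, 1/4)`) such that for
every `Q` with `NoExceptionalZeroUpTo Q c₀`, every modulus `3 ≤ q ≤ Q` and every quadratic `χ ≠ χ₀`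
mod `q`: `κ/log q ≤ Re L(1, χ)`. [cite: MontgomeryVaughan2007, §11.2 Thm. 11.14 (first case, p. 285)] -/
theorem exists_lfunction_one_re_ge_of_noExceptionalZeroUpTo (hc₀ : 0 < c₀) :
    ∃ κ : ℝ, 0 < κ ∧ ∀ Q : ℕ, NoExceptionalZeroUpTo Q c₀ →
      ∀ (q : ℕ) [NeZero q], 3 ≤ q → q ≤ Q → ∀ χ : DirichletCharacter ℂ q, χ.IsQuadratic → χ ≠ 1 →
        κ / Real.log q ≤ (χ.LFunction 1).re := by
  refine ⟨estermannC * min c₀ (1 / 4) *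
      Real.exp (-(estermannA * min c₀ (1 / 4) * (1 + Real.log ballConst))), ?_,
    fun Q h q _ hq3 hqQ χ hquad hχ ↦ h.lfunction_one_re_ge hc₀ hq3 hqQ χ hquad hχ⟩
  have hC0 : 0 < estermannC := estermannC_pos
  have hm0 : 0 < min c₀ (1 / 4) := lt_min hc₀ (by norm_num)
  positivity

end Literature.NumberTheory.LFunctions

end
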